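import Summits.Ventures.HodgeRepro2.T5LocalNormIndex
import Summits.Ventures.HodgeRepro2.T5TameRamifiedNormGroup

/-!
# Every element of `F_v` is a sum of two norms from `E_w` at a non-dyadic non-split place
(cell pub-hodge-repro2, seat p3)

Tier-5 N2 support, rows N2.2.2 / N2.8.1 of route/T5-N2-route-3.md — the local input `(U′)` behind the binary
universality `(U)` of file 136: on seat p4's completions `Kᵥ ⊆ L_w` with `[L_w : Kᵥ] = 2`, `σ ≠ 1` the non-trivial
automorphism and `normGroup v w σ = N L_wˣ ⊆ Kᵥˣ` (`T5AdicCompletionNormGroup`), when `2` is a unit of `O_Kᵥ`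
(`v ∤ 2`) EVERY `y ∈ Kᵥˣ` is `x₁ σ x₁ + x₂ σ x₂` for some `x₁, x₂ ∈ L_w` (`isSumTwoNorms`):

* a norm is a sum of two norms (`isSumTwoNorms_of_mem`, `x₂ = 0`) and the sums are stable under multiplication by
  norms (`isSumTwoNorms_mul_of_mem`);
* INERT place (p4's `T5AdicCompletionNormGroup`: `N = {y | log v y even}`, units are norms; any residue
  characteristic): a non-norm `y = u ϖ^{−l}` with `l` odd is `(u ϖ) · (ϖ^{k})²` and `u ϖ = 1 + (u ϖ − 1)` with
  `v (u ϖ − 1) = 1`, a unit, hence a norm (`isSumTwoNorms_of_irreducible`);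
* TAMELY RAMIFIED place (p4's `T5TameRamifiedNormGroup`: a uniformiser `ρ ∈ N`, a unit is a norm iff its residue is
  a square): a non-norm `y = u ρ^m` has a unit `u` of non-square residue; in the finite residue field of odd
  characteristic every element is a sum of two squares (`exists_sq_add_sq`, from Mathlib's
  `FiniteField.exists_root_sum_quadratic`), a non-square `ū = a'² + b'²` with `a', b' ≠ 0`; lifting `a'` to a unit
  `a`, `u = a² + (u − a²)` with `a² = N(a)` and `u − a²` a unit of square residue `b'²`, hence a norm
  (`isSumTwoNorms_of_not_irreducible`);
* `isSumTwoNorms`: the two cases through the dichotomy `Irreducible (alg ϖ)` / not (as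
  `T5LocalNormIndex.index_normGroup_eq_two`).

O'Meara 63:19 / Jacobowitz 1962 reach this through the isotropy of quinary quadratic forms; here the index-two
structure of the norm group (p4's chain) replaces it at the non-dyadic places. The dyadic places (`2 ∉ O_Kᵥˣ`)
are NOT covered. Mathlib + seat p4's chain only; no display; no device. §8(d): uses an L-value-free non-vanishing
device: NO.
-/

namespace Summit.Ventures.HodgeRepro2.T5FinitePlaceSumTwoNorms

open IsDedekindDomain HeightOneSpectrum IsLocalRing WithZero
  Summit.Ventures.HodgeRepro2.T5AdicCompletionNormGroup Summit.Ventures.HodgeRepro2.T5TameRamifiedNormGroup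
  Summit.Ventures.HodgeRepro2.T5LocalNormIndex

section FiniteField

variable {k : Type*} [Field k] [Fintype k]

/-- In a finite field of odd characteristic every element is a sum of two squares (Mathlib's
`FiniteField.exists_root_sum_quadratic` with `f = X²`, `g = X² − x`, as in `ZMod.sq_add_sq`). -/
theorem exists_sq_add_sq (hk : ringChar k ≠ 2) (x : k) : ∃ a b : k, a ^ 2 + b ^ 2 = x := by
  obtain ⟨a, b, hab⟩ := FiniteField.exists_root_sum_quadratic (f := (Polynomial.X ^ 2 : Polynomial k))
    (g := Polynomial.X ^ 2 - Polynomial.C x) (Polynomial.degree_X_pow 2)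
    (Polynomial.degree_X_pow_sub_C two_pos x) (FiniteField.odd_card_of_char_ne_two hk)
  refine ⟨a, b, ?_⟩
  simp only [Polynomial.eval_pow, Polynomial.eval_X, Polynomial.eval_sub, Polynomial.eval_C] at hab
  linear_combination hab

/-- A non-square of a finite field of odd characteristic is a sum of two NON-ZERO squares. -/
theorem exists_sq_add_sq_ne_zero (hk : ringChar k ≠ 2) {x : k} (hx : ¬ IsSquare x) :
    ∃ a b : k, a ≠ 0 ∧ b ≠ 0 ∧ a ^ 2 + b ^ 2 = x := by
  obtain ⟨a, b, hab⟩ := exists_sq_add_sq hk x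
  refine ⟨a, b, ?_, ?_, hab⟩
  · rintro rfl
    exact hx ⟨b, by rw [← hab]; ring⟩
  · rintro rfl
    exact hx ⟨a, by rw [← hab]; ring⟩

end FiniteField

section Local

variable {K : Type*} [Field K] [NumberField K] (v : HeightOneSpectrum (NumberField.RingOfIntegers K))
  {L : Type*} [Field L] [NumberField L] [Algebra K L]
  (w : HeightOneSpectrum (NumberField.RingOfIntegers L)) [w.asIdeal.LiesOver v.asIdeal]
  (σ : Gal(adicCompletion L w/adicCompletion K v))

/-- `y ∈ Kᵥ` is a sum of two norms from `L_w`: `y = x₁ σ x₁ + x₂ σ x₂` (zero summands allowed). -/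
def IsSumTwoNorms (y : adicCompletion K v) : Prop :=
  ∃ x₁ x₂ : adicCompletion L w,
    x₁ * σ x₁ + x₂ * σ x₂ = algebraMap (adicCompletion K v) (adicCompletion L w) y

/-- A norm is a sum of two norms. -/
theorem isSumTwoNorms_of_mem {y : (adicCompletion K v)ˣ} (hy : y ∈ normGroup v w σ) :
    IsSumTwoNorms v w σ y := by
  obtain ⟨x, hx⟩ := hy
  exact ⟨x, 0, by rw [map_zero, mul_zero, add_zero]; exact hx⟩

/-- `0` is a sum of two norms. -/
theorem isSumTwoNorms_zero : IsSumTwoNorms v w σ 0 :=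
  ⟨0, 0, by simp⟩

/-- Sums of two norms are stable under multiplication by a norm. -/
theorem isSumTwoNorms_mul_of_mem {y : adicCompletion K v} (hy : IsSumTwoNorms v w σ y)
    {n : (adicCompletion K v)ˣ} (hn : n ∈ normGroup v w σ) : IsSumTwoNorms v w σ (y * n) := by
  obtain ⟨x₁, x₂, hx⟩ := hy
  obtain ⟨z, hz⟩ := hn
  refine ⟨x₁ * z, x₂ * z, ?_⟩
  rw [map_mul σ x₁ z, map_mul σ x₂ z, map_mul (algebraMap _ _) y (n : adicCompletion K v), ← hx, ← hz]
  ring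

variable (h2 : Module.finrank (adicCompletion K v) (adicCompletion L w) = 2) (hσ : σ ≠ 1)
  {ϖ : adicCompletionIntegers K v} (hϖ : Irreducible ϖ)

include h2 hσ hϖ in
/-- **Inert place:** every unit of `Kᵥ` is a sum of two norms (any residue characteristic). A non-norm is
`u ϖ^{−l}` with `l` odd (p4's `mem_normGroup_iff_even`); `u ϖ = 1 + (u ϖ − 1)` with `u ϖ − 1` a unit, hence a
norm, and `ϖ^{−l−1}` is a square. -/
theorem isSumTwoNorms_of_irreducible
    (hϖS : Irreducible (algebraMap (adicCompletionIntegers K v) (adicCompletionIntegers L w) ϖ))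
    (y : (adicCompletion K v)ˣ) : IsSumTwoNorms v w σ y := by
  by_cases hy : y ∈ normGroup v w σ
  · exact isSumTwoNorms_of_mem v w σ hy
  rw [mem_normGroup_iff_even v w σ h2 hϖ hϖS hσ, Int.not_even_iff_odd] at hy
  obtain ⟨k, hk⟩ := hy
  obtain ⟨u, hu1, hu⟩ := T5UnramifiedCharacter.exists_val_eq_one_mul_zpow (val_uniformizer v hϖ) y.ne_zero
  have hϖ0 : (ϖ : adicCompletion K v) ≠ 0 := by exact_mod_cast hϖ.ne_zero
  -- `y = (u ϖ) · (ϖ^{−k−1})²`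
  have hy' : (y : adicCompletion K v) =
      u * (ϖ : adicCompletion K v) * (((uniformizerUnit v hϖ ^ (-k - 1)) ^ 2 : (adicCompletion K v)ˣ) :
        adicCompletion K v) := by
    rw [hu, hk, Units.val_pow_eq_pow_val, Units.val_zpow_eq_zpow_val, coe_uniformizerUnit,
      show -(2 * k + 1) = 1 + (-k - 1) * 2 by ring, zpow_add₀ hϖ0, zpow_one, zpow_mul, zpow_ofNat]
    ring
  -- `u ϖ = 1 + (u ϖ − 1)`, and `u ϖ − 1` is a unit of `Kᵥ` (a norm)
  have hv1 : Valued.v (u * (ϖ : adicCompletion K v) - 1) = 1 := by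
    rw [Valuation.map_sub_eq_of_lt_right, map_one]
    rw [map_one, map_mul, hu1, one_mul, val_uniformizer v hϖ, ← exp_zero, exp_lt_exp]
    norm_num
  have hne : u * (ϖ : adicCompletion K v) - 1 ≠ 0 := by
    intro h
    rw [h, map_zero] at hv1
    exact zero_ne_one hv1
  have hsum : IsSumTwoNorms v w σ (u * (ϖ : adicCompletion K v)) := by
    obtain ⟨x₂, hx₂⟩ := mem_normGroup_of_val_eq_one v w σ h2 hϖ hϖS hσ (y := Units.mk0 _ hne) hv1
    refine ⟨1, x₂, ?_⟩
    rw [map_one, mul_one, hx₂, Units.val_mk0, map_sub, map_one]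
    ring
  rw [hy']
  exact isSumTwoNorms_mul_of_mem v w σ hsum (T5NormGroupOpen.sq_mem_normGroup v w σ _)

include h2 hσ hϖ in
/-- **Tamely ramified place:** every unit of `Kᵥ` is a sum of two norms when `2 ∈ O_Kᵥˣ`. A non-norm is
`u ρ^m` with `ρ ∈ N` a uniformiser and `u` a unit of non-square residue (p4's `T5TameRamifiedNormGroup`);
`ū = a'² + b'²` with `a', b' ≠ 0` in the residue field; lifting `a'` to a unit `a`, `u = a² + (u − a²)` with
`a² = N(a)` and `u − a²` a unit of square residue `b'²`, hence a norm. -/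
theorem isSumTwoNorms_of_not_irreducible {π : adicCompletionIntegers L w} (hπ : Irreducible π)
    (hram : ¬ Irreducible (algebraMap (adicCompletionIntegers K v) (adicCompletionIntegers L w) ϖ))
    (h2u : IsUnit (2 : adicCompletionIntegers K v)) (y : (adicCompletion K v)ˣ) :
    IsSumTwoNorms v w σ y := by
  by_cases hy : y ∈ normGroup v w σ
  · exact isSumTwoNorms_of_mem v w σ hy
  obtain ⟨θ, hθ, hθv⟩ := exists_anti_val_eq_exp_neg_one v w σ h2 hϖ hπ hram hσ h2u
  obtain ⟨ρ, hρv, hρN⟩ := exists_uniformizer_mem_normGroup v w σ h2 hϖ hπ hram hσ hθ hθv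
  obtain ⟨u, hu1, hu⟩ := T5UnramifiedCharacter.exists_val_eq_one_mul_zpow hρv y.ne_zero
  have hu0 : u ≠ 0 := by
    intro h0
    rw [h0, map_zero] at hu1
    exact zero_ne_one hu1
  have hρm : ρ ^ (-(Valued.v (y : adicCompletion K v)).log) ∈ normGroup v w σ :=
    Subgroup.zpow_mem _ hρN _
  have hyu : (y : adicCompletion K v) = u * ((ρ ^ (-(Valued.v (y : adicCompletion K v)).log) :
      (adicCompletion K v)ˣ) : adicCompletion K v) := by
    rw [Units.val_zpow_eq_zpow_val]
    exact hu
  -- the unit `u` is not a norm, so its residue is not a square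
  have huN : Units.mk0 u hu0 ∉ normGroup v w σ := by
    intro h
    apply hy
    have : y = Units.mk0 u hu0 * ρ ^ (-(Valued.v (y : adicCompletion K v)).log) :=
      Units.ext (by rw [Units.val_mul, Units.val_mk0]; exact hyu)
    rw [this]
    exact Subgroup.mul_mem _ h hρm
  have humem : u ∈ adicCompletionIntegers K v := (mem_adicCompletionIntegers _ _ _).mpr hu1.le
  rw [mem_normGroup_iff_isSquare_residue v w σ h2 hϖ hπ hram hσ h2u (Units.mk0 u hu0) hu1] at huN
  change ¬ IsSquare (residue (adicCompletionIntegers K v) ⟨u, humem⟩) at huN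
  -- two squares in the residue field
  haveI : Fintype (ResidueField (adicCompletionIntegers K v)) := Fintype.ofFinite _
  obtain ⟨a', b', ha0, hb0, hab⟩ :=
    exists_sq_add_sq_ne_zero (T5TameRamifiedUnitNorms.ringChar_residueField_ne_two v h2u) huN
  obtain ⟨a, rfl⟩ := residue_surjective a'
  -- `t = u − a²` is a unit of square residue `b'²`
  obtain ⟨t, ht⟩ : ∃ t : adicCompletionIntegers K v, t = ⟨u, humem⟩ - a ^ 2 := ⟨_, rfl⟩
  have hres : residue (adicCompletionIntegers K v) t = b' ^ 2 := by
    rw [ht, map_sub, map_pow, ← hab]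
    ring
  have htU : IsUnit t := (residue_ne_zero_iff_isUnit t).1 (by rw [hres]; exact pow_ne_zero 2 hb0)
  have htv : Valued.v (t : adicCompletion K v) = 1 := by
    have h := T5AdicCompletionHenselian.val_coe_units_eq_one v htU.unit
    rwa [IsUnit.unit_spec] at h
  have ht0 : (t : adicCompletion K v) ≠ 0 := by
    intro h
    rw [h, map_zero] at htv
    exact zero_ne_one htv
  have htN : Units.mk0 (t : adicCompletion K v) ht0 ∈ normGroup v w σ := by
    rw [mem_normGroup_iff_isSquare_residue v w σ h2 hϖ hπ hram hσ h2u
      (Units.mk0 (t : adicCompletion K v) ht0) (by rw [Units.val_mk0]; exact htv)]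
    have hcoe : ∀ p : ((Units.mk0 (t : adicCompletion K v) ht0 : (adicCompletion K v)ˣ) :
        adicCompletion K v) ∈ adicCompletionIntegers K v, (⟨_, p⟩ : adicCompletionIntegers K v) = t :=
      fun _ => Subtype.ext rfl
    rw [hcoe, hres, sq]
    exact ⟨b', rfl⟩
  -- `u = a² + t` with `a² = N(alg a)`
  have hsum : IsSumTwoNorms v w σ u := by
    obtain ⟨x₂, hx₂⟩ := htN
    refine ⟨algebraMap (adicCompletion K v) (adicCompletion L w) (a : adicCompletion K v), x₂, ?_⟩
    rw [σ.commutes, hx₂, Units.val_mk0, ← map_mul, ← map_add]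
    congr 1
    rw [ht]
    push_cast
    ring
  rw [hyu]
  exact isSumTwoNorms_mul_of_mem v w σ hsum hρm

include h2 hσ in
/-- **`(U′)` at a non-dyadic non-split place:** every unit of `Kᵥ` is a sum of two norms from `L_w`
(`[L_w : Kᵥ] = 2`, `σ ≠ 1`, `2 ∈ O_Kᵥˣ`): inert places by `isSumTwoNorms_of_irreducible`, ramified places by
`isSumTwoNorms_of_not_irreducible`. -/
theorem isSumTwoNorms (h2u : IsUnit (2 : adicCompletionIntegers K v)) (y : (adicCompletion K v)ˣ) :
    IsSumTwoNorms v w σ y := by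
  obtain ⟨ϖ, hϖ⟩ := exists_irreducible_adicCompletionIntegers v
  obtain ⟨π, hπ⟩ := exists_irreducible_adicCompletionIntegers w
  by_cases hS : Irreducible (algebraMap (adicCompletionIntegers K v) (adicCompletionIntegers L w) ϖ)
  · exact isSumTwoNorms_of_irreducible v w σ h2 hσ hϖ hS y
  · exact isSumTwoNorms_of_not_irreducible v w σ h2 hσ hϖ hπ hS h2u y

include h2 hσ in
/-- `(U′)` for every element of `Kᵥ` (zero included). -/
theorem isSumTwoNorms' (h2u : IsUnit (2 : adicCompletionIntegers K v)) (y : adicCompletion K v) :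
    IsSumTwoNorms v w σ y := by
  by_cases hy : y = 0
  · rw [hy]
    exact isSumTwoNorms_zero v w σ
  · exact isSumTwoNorms v w σ h2 hσ h2u (Units.mk0 y hy)

end Local

end Summit.Ventures.HodgeRepro2.T5FinitePlaceSumTwoNorms
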